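import Summits.CriticalPhenomena.PercolationContinuityZ3.Theorems.PercNearOneGluingNoHeavyLowerTailSahiCombTriWCommonBottom
import Summits.CriticalPhenomena.PercolationContinuityZ3.Theorems.PercNearOneGluingNoHeavyLowerTailSahiCombTriWAntiNestedKernelProof

/-!
# `TRI_W(2) ≥ 0` on the HALF-CHAIN stratum with the test set inside the top of `F` (`G{a} ⊆ G{b}`, `P ⊆ F univ`) — an explicit five-up-set certificate

Support file of the one-cut programme (crux `NoHeavyLowerTail`, stmt-CriticalPhenomena-4575; cell `prim-masterthm`, seat P5 gen 28;
memo `FROM-prim-masterthm-p5-g28-HALFCHAIN-CERTIFICATES.md`).  Target `FiveUpSet.TriWIneq` (`…SahiCombTriWGeneral`), OPEN for index cubes of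
dimension `a ≥ 2`; recommended sub-target of the lane: the half-chain stratum `FiveUpSet.HalfChainMidIneq` (`…TriWHalfChainMid`, P5 gen 27:
`G{a} ⊆ G{b}`, `F` an arbitrary diamond).  At `a = 2` the pair reduction `LatticeFiveUpSet.triW_nonneg_of_pair_nonneg` reduces `TriWIneq` to
`0 ≤ triWOne c P F₀ F₁ G₀ G₁ + triWOne c P Fp Fq Gp Gq` for two diamonds of up-sets `F₀ ⊆ Fp, Fq ⊆ F₁`, `G₀ ⊆ Gp, Gq ⊆ G₁`.

* **`FiveUpSet.inner_pair_le_of_halfChain_testInFTop`** / **`FiveUpSet.triW_nonneg_of_halfChain_testInFTop`** — `Gp ⊆ Gq` and `P ⊆ F₁` ⟹ the pair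
  sum is `≥ 0`; hence `0 ≤ triW P F G` for monotone families over a two-atom index cube with `G{a} ⊆ G{b}` and `P ⊆ F univ`
  (`F ∅ ≠ ∅` and incomparable `F`-middles allowed; companion of `…TriWHalfChainTopGe` = the side condition `G univ ⊆ F univ`).
  CERTIFICATE (multiplier 2; seven five-up-set instances `fiveUpSetIneq_holds` with arguments in the lattice generated by the nine sets and `P`,
  among them the test sets `P ∩ Fp`, `Fp`, `F₁`, `univ` and the nested pairs `∅ ⊆ P`, `Fp ∩ Gp ⊆ F₁ ∩ Gp`, `F₀ ∩ G₀ ⊆ F₀ ∩ G₀`, `P ∩ F₀ ⊆ P ∩ F₀`, `P ∩ G₀ ⊆ P ∩ G₀`;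
  remainder non-negative on every antipodal pair `{w, wᶜ}` — `sum_nonneg_of_compl_pair`, kernel `decide` over the `6⁴` diamond positions).
  Found by EXACT LP column generation (C pricer over all five-up-set / Kleitman atoms with intersection arguments + alternating search over all
  type up-sets; P5 gen 28 `work/py/cg3.py`), verified beforehand on 4·10⁵ random genuine configurations.  The same LP for the WHOLE half-chain
  stratum is infeasible over this atom family already on its sub-stratum `G ∅ = G{a} = ∅` (fooling value `1/7`).
HONEST LABEL: one new unconditional stratum of `TriWIneq` at `a = 2`; `TriWIneq` and `HalfChainMidIneq` remain OPEN. [this work]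
-/

namespace Summit.CriticalPhenomena.PercolationContinuityZ3.Theorems

namespace FiveUpSet

open Finset LatticeFiveUpSet

variable {γ : Type} [DecidableEq γ] [Fintype γ]

set_option synthInstance.maxHeartbeats 400000 in
set_option synthInstance.maxSize 4096 in
set_option maxHeartbeats 1600000 in
/-- **`TRI_W(2) ≥ 0` on the HALF-CHAIN stratum `G{a} ⊆ G{b}` with P ⊆ F univ (the test set inside the top of the OTHER family; contains F univ = univ), pair form** (explicit certificate: 7 five-up-set instance(s), multiplier `2`,
remainder non-negative on every antipodal pair; found by exact LP column generation, P5 gen 28). [this work] -/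
theorem inner_pair_le_of_halfChain_testInFTop (P F₀ Fp Fq F₁ G₀ Gp Gq G₁ : Finset (Finset γ)) (hP : IsUpperSet (P : Set (Finset γ)))
    (hF₀ : IsUpperSet (F₀ : Set (Finset γ))) (hFp : IsUpperSet (Fp : Set (Finset γ))) (hFq : IsUpperSet (Fq : Set (Finset γ)))
    (hF₁ : IsUpperSet (F₁ : Set (Finset γ))) (hG₀ : IsUpperSet (G₀ : Set (Finset γ))) (hGp : IsUpperSet (Gp : Set (Finset γ)))
    (hGq : IsUpperSet (Gq : Set (Finset γ))) (hG₁ : IsUpperSet (G₁ : Set (Finset γ)))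
    (hF0p : F₀ ⊆ Fp) (hF0q : F₀ ⊆ Fq) (hFp1 : Fp ⊆ F₁) (hFq1 : Fq ⊆ F₁)
    (hG0p : G₀ ⊆ Gp) (hG0q : G₀ ⊆ Gq) (hGp1 : Gp ⊆ G₁) (hGq1 : Gq ⊆ G₁) (hGpq : Gp ⊆ Gq) (hPF : P ⊆ F₁) :
    0 ≤ triWOne (complEquiv γ) P F₀ F₁ G₀ G₁ + triWOne (complEquiv γ) P Fp Fq Gp Gq := by
  rw [triWOne_expand, triWOne_expand]
  have hW : IsUpperSet ((univ : Finset (Finset γ)) : Set (Finset γ)) := by rw [coe_univ]; exact isUpperSet_univ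
  have hE : IsUpperSet ((∅ : Finset (Finset γ)) : Set (Finset γ)) := isUpperSet_empty
  have hPFp : IsUpperSet ((P ∩ Fp : Finset (Finset γ)) : Set (Finset γ)) := by rw [coe_inter]; exact hP.inter hFp
  have hPF0 : IsUpperSet ((P ∩ F₀ : Finset (Finset γ)) : Set (Finset γ)) := by rw [coe_inter]; exact hP.inter hF₀
  have hPG0 : IsUpperSet ((P ∩ G₀ : Finset (Finset γ)) : Set (Finset γ)) := by rw [coe_inter]; exact hP.inter hG₀
  have hF0G0 : IsUpperSet ((F₀ ∩ G₀ : Finset (Finset γ)) : Set (Finset γ)) := by rw [coe_inter]; exact hF₀.inter hG₀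
  have hFpGp : IsUpperSet ((Fp ∩ Gp : Finset (Finset γ)) : Set (Finset γ)) := by rw [coe_inter]; exact hFp.inter hGp
  have hF1Gp : IsUpperSet ((F₁ ∩ Gp : Finset (Finset γ)) : Set (Finset γ)) := by rw [coe_inter]; exact hF₁.inter hGp
  have h1 := fiveUpSetIneq_holds γ (P ∩ Fp) Fp univ ∅ Gq hPFp hFp hW hE hGq (subset_univ _) (empty_subset _)
  have h1' : 0 ≤ ((((P ∩ Fp) ∩ univ ∩ Gq).card : ℤ) + (((P ∩ Fp) ∩ Fp ∩ ∅).card : ℤ) - (((P ∩ Fp) ∩ univ ∩ refl ∅).card : ℤ) - (((P ∩ Fp) ∩ refl Fp ∩ Gq).card : ℤ) - (((P ∩ Fp) ∩ refl (univ \ Fp) ∩ refl (Gq \ ∅)).card : ℤ)) := by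
    have := h1; omega
  have h2 := fiveUpSetIneq_holds γ P Gp Gq ∅ Fq hP hGp hGq hE hFq hGpq (empty_subset _)
  have h2' : 0 ≤ (((P ∩ Gq ∩ Fq).card : ℤ) + ((P ∩ Gp ∩ ∅).card : ℤ) - ((P ∩ Gq ∩ refl ∅).card : ℤ) - ((P ∩ refl Gp ∩ Fq).card : ℤ) - ((P ∩ refl (Gq \ Gp) ∩ refl (Fq \ ∅)).card : ℤ)) := by
    have := h2; omega
  have h3 := fiveUpSetIneq_holds γ P F₀ univ ∅ G₁ hP hF₀ hW hE hG₁ (subset_univ _) (empty_subset _)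
  have h3' : 0 ≤ (((P ∩ univ ∩ G₁).card : ℤ) + ((P ∩ F₀ ∩ ∅).card : ℤ) - ((P ∩ univ ∩ refl ∅).card : ℤ) - ((P ∩ refl F₀ ∩ G₁).card : ℤ) - ((P ∩ refl (univ \ F₀) ∩ refl (G₁ \ ∅)).card : ℤ)) := by
    have := h3; omega
  have h4 := fiveUpSetIneq_holds γ Fp ∅ P (Fp ∩ Gp) (F₁ ∩ Gp) hFp hE hP hFpGp hF1Gp (empty_subset _) (inter_subset_inter hFp1 subset_rfl)
  have h4' : 0 ≤ (((Fp ∩ P ∩ (F₁ ∩ Gp)).card : ℤ) + ((Fp ∩ ∅ ∩ (Fp ∩ Gp)).card : ℤ) - ((Fp ∩ P ∩ refl (Fp ∩ Gp)).card : ℤ) - ((Fp ∩ refl ∅ ∩ (F₁ ∩ Gp)).card : ℤ) - ((Fp ∩ refl (P \ ∅) ∩ refl ((F₁ ∩ Gp) \ (Fp ∩ Gp))).card : ℤ)) := by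
    have := h4; omega
  have h5 := fiveUpSetIneq_holds γ F₁ (F₀ ∩ G₀) (F₀ ∩ G₀) P P hF₁ hF0G0 hF0G0 hP hP subset_rfl subset_rfl
  have h5' : 0 ≤ (((F₁ ∩ (F₀ ∩ G₀) ∩ P).card : ℤ) + ((F₁ ∩ (F₀ ∩ G₀) ∩ P).card : ℤ) - ((F₁ ∩ (F₀ ∩ G₀) ∩ refl P).card : ℤ) - ((F₁ ∩ refl (F₀ ∩ G₀) ∩ P).card : ℤ) - ((F₁ ∩ refl ((F₀ ∩ G₀) \ (F₀ ∩ G₀)) ∩ refl (P \ P)).card : ℤ)) := by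
    have := h5; omega
  have h6 := fiveUpSetIneq_holds γ univ G₁ G₁ (P ∩ F₀) (P ∩ F₀) hW hG₁ hG₁ hPF0 hPF0 subset_rfl subset_rfl
  have h6' : 0 ≤ (((univ ∩ G₁ ∩ (P ∩ F₀)).card : ℤ) + ((univ ∩ G₁ ∩ (P ∩ F₀)).card : ℤ) - ((univ ∩ G₁ ∩ refl (P ∩ F₀)).card : ℤ) - ((univ ∩ refl G₁ ∩ (P ∩ F₀)).card : ℤ) - ((univ ∩ refl (G₁ \ G₁) ∩ refl ((P ∩ F₀) \ (P ∩ F₀))).card : ℤ)) := by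
    have := h6; omega
  have h7 := fiveUpSetIneq_holds γ F₁ Fq Fq (P ∩ G₀) (P ∩ G₀) hF₁ hFq hFq hPG0 hPG0 subset_rfl subset_rfl
  have h7' : 0 ≤ (((F₁ ∩ Fq ∩ (P ∩ G₀)).card : ℤ) + ((F₁ ∩ Fq ∩ (P ∩ G₀)).card : ℤ) - ((F₁ ∩ Fq ∩ refl (P ∩ G₀)).card : ℤ) - ((F₁ ∩ refl Fq ∩ (P ∩ G₀)).card : ℤ) - ((F₁ ∩ refl (Fq \ Fq) ∩ refl ((P ∩ G₀) \ (P ∩ G₀))).card : ℤ)) := by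
    have := h7; omega
  have hR : 0 ≤ 2 * ((2 * (((P ∩ F₀ ∩ G₀).card : ℤ) + ((P ∩ F₁ ∩ G₁).card : ℤ)) - (((P ∩ refl F₀ ∩ G₁).card : ℤ) + ((P ∩ refl F₁ ∩ G₀).card : ℤ)) - (((P ∩ F₀ ∩ refl G₁).card : ℤ) + ((P ∩ F₁ ∩ refl G₀).card : ℤ)) - (((P ∩ refl F₀ ∩ refl G₀).card : ℤ) + ((P ∩ refl F₁ ∩ refl G₁).card : ℤ)) + (((P ∩ refl F₀ ∩ refl G₁).card : ℤ) + ((P ∩ refl F₁ ∩ refl G₀).card : ℤ))) + (2 * (((P ∩ Fp ∩ Gp).card : ℤ) + ((P ∩ Fq ∩ Gq).card : ℤ)) - (((P ∩ refl Fp ∩ Gq).card : ℤ) + ((P ∩ refl Fq ∩ Gp).card : ℤ)) - (((P ∩ Fp ∩ refl Gq).card : ℤ) + ((P ∩ Fq ∩ refl Gp).card : ℤ)) - (((P ∩ refl Fp ∩ refl Gp).card : ℤ) + ((P ∩ refl Fq ∩ refl Gq).card : ℤ)) + (((P ∩ refl Fp ∩ refl Gq).card : ℤ) + ((P ∩ refl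 Fq ∩ refl Gp).card : ℤ)))) - (2 * ((((P ∩ Fp) ∩ univ ∩ Gq).card : ℤ) + (((P ∩ Fp) ∩ Fp ∩ ∅).card : ℤ) - (((P ∩ Fp) ∩ univ ∩ refl ∅).card : ℤ) - (((P ∩ Fp) ∩ refl Fp ∩ Gq).card : ℤ) - (((P ∩ Fp) ∩ refl (univ \ Fp) ∩ refl (Gq \ ∅)).card : ℤ)) + 2 * (((P ∩ Gq ∩ Fq).card : ℤ) + ((P ∩ Gp ∩ ∅).card : ℤ) - ((P ∩ Gq ∩ refl ∅).card : ℤ) - ((P ∩ refl Gp ∩ Fq).card : ℤ) - ((P ∩ refl (Gq \ Gp) ∩ refl (Fq \ ∅)).card : ℤ)) + 2 * (((P ∩ univ ∩ G₁).card : ℤ) + ((P ∩ F₀ ∩ ∅).card : ℤ) - ((P ∩ univ ∩ refl ∅).card : ℤ) - ((P ∩ refl F₀ ∩ G₁).card : ℤ) - ((P ∩ refl (univ \ F₀) ∩ refl (G₁ \ ∅)).card : ℤ)) + 2 * (((Fp ∩ P ∩ (F₁ ∩ Gp)).card : ℤ) + ((Fp ∩ ∅ ∩ (Fp ∩ Gp)).card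 : ℤ) - ((Fp ∩ P ∩ refl (Fp ∩ Gp)).card : ℤ) - ((Fp ∩ refl ∅ ∩ (F₁ ∩ Gp)).card : ℤ) - ((Fp ∩ refl (P \ ∅) ∩ refl ((F₁ ∩ Gp) \ (Fp ∩ Gp))).card : ℤ)) + 1 * (((F₁ ∩ (F₀ ∩ G₀) ∩ P).card : ℤ) + ((F₁ ∩ (F₀ ∩ G₀) ∩ P).card : ℤ) - ((F₁ ∩ (F₀ ∩ G₀) ∩ refl P).card : ℤ) - ((F₁ ∩ refl (F₀ ∩ G₀) ∩ P).card : ℤ) - ((F₁ ∩ refl ((F₀ ∩ G₀) \ (F₀ ∩ G₀)) ∩ refl (P \ P)).card : ℤ)) + 1 * (((univ ∩ G₁ ∩ (P ∩ F₀)).card : ℤ) + ((univ ∩ G₁ ∩ (P ∩ F₀)).card : ℤ) - ((univ ∩ G₁ ∩ refl (P ∩ F₀)).card : ℤ) - ((univ ∩ refl G₁ ∩ (P ∩ F₀)).card : ℤ) - ((univ ∩ refl (G₁ \ G₁) ∩ refl ((P ∩ F₀) \ (P ∩ F₀))).card : ℤ)) + 1 * (((F₁ ∩ Fq ∩ (P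 ∩ G₀)).card : ℤ) + ((F₁ ∩ Fq ∩ (P ∩ G₀)).card : ℤ) - ((F₁ ∩ Fq ∩ refl (P ∩ G₀)).card : ℤ) - ((F₁ ∩ refl Fq ∩ (P ∩ G₀)).card : ℤ) - ((F₁ ∩ refl (Fq \ Fq) ∩ refl ((P ∩ G₀) \ (P ∩ G₀))).card : ℤ))) := by
    simp only [card_eq_univ_sum]
    simp only [mem_inter, mem_refl, mem_sdiff, Finset.notMem_empty, Finset.mem_univ]
    simp only [mul_add, mul_sub]
    simp only [Finset.mul_sum, ← Finset.sum_add_distrib, ← Finset.sum_sub_distrib]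
    refine sum_nonneg_of_compl_pair (fun w => ?_)
    simp only [compl_compl]
    obtain ⟨s₁, a0, ap, aq, a1⟩ := diamond_pos hF0p hF0q hFp1 hFq1 w
    obtain ⟨s₂, b0, bp, bq, b1⟩ := diamond_pos hG0p hG0q hGp1 hGq1 w
    obtain ⟨s₃, c0, cp, cq, c1⟩ := diamond_pos hF0p hF0q hFp1 hFq1 wᶜ
    obtain ⟨s₄, d0, dp, dq, d1⟩ := diamond_pos hG0p hG0q hGp1 hGq1 wᶜ
    have gpq : (s₂ = 2 ∨ s₂ = 4 ∨ s₂ = 5) → (s₂ = 3 ∨ s₂ = 4 ∨ s₂ = 5) := fun h => bq.mp (hGpq (bp.mpr h))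
    have gpq' : (s₄ = 2 ∨ s₄ = 4 ∨ s₄ = 5) → (s₄ = 3 ∨ s₄ = 4 ∨ s₄ = 5) := fun h => dq.mp (hGpq (dp.mpr h))
    have pf : w ∈ P → s₁ ≠ 0 := fun h => a1.mp (hPF h)
    have qf : wᶜ ∈ P → s₃ ≠ 0 := fun h => c1.mp (hPF h)
    simp only [a0, ap, aq, a1, b0, bp, bq, b1, c0, cp, cq, c1, d0, dp, dq, d1]
    clear a0 ap aq a1 b0 bp bq b1 c0 cp cq c1 d0 dp dq d1
    by_cases hp : w ∈ P
    · have pf' := pf hp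
      by_cases hq : wᶜ ∈ P
      · have qf' := qf hq; clear pf qf; simp only [hp, hq]; revert s₁ s₂ s₃ s₄; decide
      · clear pf qf; simp only [hp, hq]; revert s₁ s₂ s₃ s₄; decide
    · by_cases hq : wᶜ ∈ P
      · have qf' := qf hq; clear pf qf; simp only [hp, hq]; revert s₁ s₂ s₃ s₄; decide
      · clear pf qf; simp only [hp, hq]; revert s₁ s₂ s₃ s₄; decide
  linarith [hR, h1', h2', h3', h4', h5', h6', h7']

/-- **STRATUM of `TRI_W(2) ≥ 0` (unconditional): `G` a HALF-CHAIN (`G{a} ⊆ G{b}`) and P ⊆ F univ (the test set inside the top of the OTHER family; contains F univ = univ); `F` ARBITRARY.**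
Index cube with two atoms `a ≠ b`, up-set `P`, monotone families `F, G` of up-sets of a finite cube: `0 ≤ triW P F G`.
Pair reduction `LatticeFiveUpSet.triW_nonneg_of_pair_nonneg` + `inner_pair_le_of_halfChain_testInFTop`. [this work] -/
theorem triW_nonneg_of_halfChain_testInFTop {β : Type} [DecidableEq β] [Fintype β] {a b : β} (hab : a ≠ b) (hu : (univ : Finset β) = {a, b})
    (P : Finset (Finset γ)) (F G : Finset β → Finset (Finset γ))
    (hP : IsUpperSet (P : Set (Finset γ))) (hF : ∀ x, IsUpperSet (F x : Set (Finset γ))) (hG : ∀ x, IsUpperSet (G x : Set (Finset γ)))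
    (hFm : Monotone F) (hGm : Monotone G) (hGab : G {a} ⊆ G {b}) (hPF : P ⊆ F univ) : 0 ≤ triW P F G := by
  refine LatticeFiveUpSet.triW_nonneg_of_pair_nonneg hab hu P F G ?_
  exact inner_pair_le_of_halfChain_testInFTop P (F ∅) (F {a}) (F {b}) (F univ) (G ∅) (G {a}) (G {b}) (G univ) hP (hF ∅) (hF {a}) (hF {b}) (hF univ)
    (hG ∅) (hG {a}) (hG {b}) (hG univ) (hFm (empty_subset _)) (hFm (empty_subset _)) (hFm (subset_univ _)) (hFm (subset_univ _))
    (hGm (empty_subset _)) (hGm (empty_subset _)) (hGm (subset_univ _)) (hGm (subset_univ _)) hGab hPF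

end FiveUpSet

end Summit.CriticalPhenomena.PercolationContinuityZ3.Theorems
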